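import Summits.BirchSwinnertonDyer.BirchSwinnertonDyer.Theorems.Rank2ObservatoryReductionWitness
import HarnessLib

/-!
# BirchSwinnertonDyer — rank ≥ 2 observatory: the kernel rank certificate, II (`u = 1`)

HONEST FRAMING: per-curve certified theorems and census instruments; no claim on BSD in rank ≥ 2.

`Rank2ObservatoryReductionWitness.lean` certifies `2 ≤ rank_ℤ E(ℚ)` when the torsion annihilator
read off the kernel point counts is ODD (`u = 0` in `two_le_mordellWeilRank_of_cosetWitness`).
A curve with a rational `2`-torsion point has every good-prime count even, so its annihilator is
`t = 2·m`, `m` odd, and the coset to avoid is `2Ẽ(𝔽_q) + Ẽ(𝔽_q)[2]` (`twoCoset _ 1`). This file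
adds the division-free COSET TEST `xCosetFree V q α β` (a Boolean for `decide`): `(α, β)` is not
`2b + c` for any `b` and any `c` with `2c = O` — for `c = O` the doubling test of part I, and for an
affine `2`-torsion `c = (x₁, y₁)` (`2y₁ + a₁x₁ + a₃ = 0`): `α ≠ x₁` and the `x`-coordinate of
`(α, β) + c` (chord, denominator `(α − x₁)²`) is not that of a double `2(x₀, y₀)` (denominator
`D² = (2y₀ + a₁x₀ + a₃)²`), cross-multiplied. Soundness `not_mem_twoCoset_one_of_xCosetFree` and the
assembly `two_le_mordellWeilRank_of_kernelCert₂` (`t % 4 = 2`, `u = 1`, `m = t / 2`).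

References: Silverman, *The Arithmetic of Elliptic Curves* (2009), III.2.3 (group law), VII.3.1(b),
VIII (weak Mordell–Weil); Cremona, *Algorithms for Modular Elliptic Curves* (1997), §3.5.
-/

-- single-conjunct summit: `Summit.BirchSwinnertonDyer.BirchSwinnertonDyer.…` repeats the name by design
set_option linter.dupNamespace false

namespace Summit.BirchSwinnertonDyer.BirchSwinnertonDyer.Rank2Observatory

open WeierstrassCurve Literature.NumberTheory.EllipticCurves

/-! ### The division-free coset test: `(α, β) ∉ 2Ẽ(𝔽_q) + Ẽ(𝔽_q)[2]` -/

section Coset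

/-- Decidable COSET TEST (a Boolean for `decide`): the doubling test `xDoubleFree V q α` AND, for
every affine `2`-torsion point `(x₁, y₁)` of the reduction (`2y₁ + a₁x₁ + a₃ = 0`), `α ≠ x₁` and for
every `(x₀, y₀)` with `D = 2y₀ + a₁x₀ + a₃ ≠ 0`:
`(n² + a₁·n·D − (a₂ + 2x₀)·D²)·(α − x₁)² ≠ (m² + a₁·m·d − (a₂ + α + x₁)·d²)·D²`,
`n = 3x₀² + 2a₂x₀ + a₄ − a₁y₀`, `d = α − x₁`, `m = β − y₁` — i.e. `x((α,β) + (x₁,y₁)) ≠ x(2(x₀,y₀))`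
with both denominators cleared (Silverman AEC III.2.3). [cite: SilvermanAEC2009, III.2.3] -/
def xCosetFree (V : WeierstrassCurve ℤ) (q : ℕ) [NeZero q] (α β : ZMod q) : Bool :=
  xDoubleFree V q α &&
  decide (∀ x₁ y₁ : ZMod q,
    y₁ ^ 2 + (V.a₁ : ZMod q) * x₁ * y₁ + (V.a₃ : ZMod q) * y₁ =
      x₁ ^ 3 + (V.a₂ : ZMod q) * x₁ ^ 2 + (V.a₄ : ZMod q) * x₁ + (V.a₆ : ZMod q) →
    2 * y₁ + (V.a₁ : ZMod q) * x₁ + (V.a₃ : ZMod q) = 0 →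
    α ≠ x₁ ∧ ∀ x₀ y₀ : ZMod q,
      y₀ ^ 2 + (V.a₁ : ZMod q) * x₀ * y₀ + (V.a₃ : ZMod q) * y₀ =
        x₀ ^ 3 + (V.a₂ : ZMod q) * x₀ ^ 2 + (V.a₄ : ZMod q) * x₀ + (V.a₆ : ZMod q) →
      2 * y₀ + (V.a₁ : ZMod q) * x₀ + (V.a₃ : ZMod q) ≠ 0 →
      ((3 * x₀ ^ 2 + 2 * (V.a₂ : ZMod q) * x₀ + (V.a₄ : ZMod q) - (V.a₁ : ZMod q) * y₀) ^ 2
          + (V.a₁ : ZMod q) * (3 * x₀ ^ 2 + 2 * (V.a₂ : ZMod q) * x₀ + (V.a₄ : ZMod q)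
              - (V.a₁ : ZMod q) * y₀) * (2 * y₀ + (V.a₁ : ZMod q) * x₀ + (V.a₃ : ZMod q))
          - ((V.a₂ : ZMod q) + 2 * x₀) * (2 * y₀ + (V.a₁ : ZMod q) * x₀ + (V.a₃ : ZMod q)) ^ 2)
        * (α - x₁) ^ 2 ≠
      ((β - y₁) ^ 2 + (V.a₁ : ZMod q) * (β - y₁) * (α - x₁)
          - ((V.a₂ : ZMod q) + α + x₁) * (α - x₁) ^ 2)
        * (2 * y₀ + (V.a₁ : ZMod q) * x₀ + (V.a₃ : ZMod q)) ^ 2)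

variable (V : WeierstrassCurve ℤ) (q : ℕ) [Fact q.Prime]

/-- **Soundness of the coset test**: if `xCosetFree V q α β = true` then `(α, β) ∉ 2Ẽ(𝔽_q) + Ẽ(𝔽_q)[2]
= twoCoset _ 1`. (`(α,β) = 2b + c`, `2c = O`: `c = O` is the doubling test; else `c = −c` is affine with
`2y₁ + a₁x₁ + a₃ = 0`, `(α,β) + c = 2b` with `α ≠ x₁`, `b` affine with non-vertical tangent, and equating
`x`-coordinates and clearing `(α − x₁)²·D²` is the tested inequation.) [cite: SilvermanAEC2009, III.2.3] -/
theorem not_mem_twoCoset_one_of_xCosetFree {α β : ZMod q} (hfree : xCosetFree V q α β = true)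
    (h : (V.map (Int.castRingHom (ZMod q))).toAffine.Nonsingular α β) :
    (Affine.Point.some α β h : (V.map (Int.castRingHom (ZMod q))).toAffine.Point) ∉
      twoCoset (V.map (Int.castRingHom (ZMod q))).toAffine.Point 1 := by
  simp only [xCosetFree, Bool.and_eq_true, decide_eq_true_eq] at hfree
  obtain ⟨hfree₀, hfree₁⟩ := hfree
  have ha₁ : (V.map (Int.castRingHom (ZMod q))).a₁ = (V.a₁ : ZMod q) := by
    simp [WeierstrassCurve.map]
  have ha₂ : (V.map (Int.castRingHom (ZMod q))).a₂ = (V.a₂ : ZMod q) := by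
    simp [WeierstrassCurve.map]
  have ha₃ : (V.map (Int.castRingHom (ZMod q))).a₃ = (V.a₃ : ZMod q) := by
    simp [WeierstrassCurve.map]
  have ha₄ : (V.map (Int.castRingHom (ZMod q))).a₄ = (V.a₄ : ZMod q) := by
    simp [WeierstrassCurve.map]
  have ha₆ : (V.map (Int.castRingHom (ZMod q))).a₆ = (V.a₆ : ZMod q) := by
    simp [WeierstrassCurve.map]
  rintro ⟨b, c, hc, hb⟩
  rw [pow_one, two_zsmul] at hc
  rcases c with _ | ⟨x₁, y₁, h₁⟩
  · rw [← Affine.Point.zero_def] at hb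
    exact not_mem_twoCoset_of_xDoubleFree V q hfree₀ h ⟨b, 0, by rw [pow_zero, one_smul], hb⟩
  · have hcneg : (Affine.Point.some x₁ y₁ h₁ : (V.map (Int.castRingHom (ZMod q))).toAffine.Point) =
        -Affine.Point.some x₁ y₁ h₁ := eq_neg_of_add_eq_zero_left hc
    rw [Affine.Point.neg_some, Affine.Point.some.injEq] at hcneg
    obtain ⟨-, hy₁⟩ := hcneg
    have heq₁ : y₁ ^ 2 + (V.a₁ : ZMod q) * x₁ * y₁ + (V.a₃ : ZMod q) * y₁ =
        x₁ ^ 3 + (V.a₂ : ZMod q) * x₁ ^ 2 + (V.a₄ : ZMod q) * x₁ + (V.a₆ : ZMod q) := by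
      have := (Affine.equation_iff x₁ y₁).mp h₁.1
      simpa only [ha₁, ha₂, ha₃, ha₄, ha₆] using this
    have hT : 2 * y₁ + (V.a₁ : ZMod q) * x₁ + (V.a₃ : ZMod q) = 0 := by
      have hval : y₁ - (V.map (Int.castRingHom (ZMod q))).toAffine.negY x₁ y₁ =
          2 * y₁ + (V.a₁ : ZMod q) * x₁ + (V.a₃ : ZMod q) := by
        simp only [Affine.negY, ha₁, ha₃]; ring
      rw [← hval, sub_eq_zero]; exact hy₁
    obtain ⟨hne, hfree₂⟩ := hfree₁ x₁ y₁ heq₁ hT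
    have hPc : (Affine.Point.some α β h : (V.map (Int.castRingHom (ZMod q))).toAffine.Point) +
        Affine.Point.some x₁ y₁ h₁ = (2 : ℤ) • b := by
      rw [hb, add_assoc, hc, add_zero]
    rw [Affine.Point.add_of_X_ne hne, two_zsmul] at hPc
    rcases b with _ | ⟨x₀, y₀, h₀⟩
    · rw [← Affine.Point.zero_def, add_zero] at hPc
      exact Affine.Point.some_ne_zero _ hPc
    · by_cases hy : y₀ = (V.map (Int.castRingHom (ZMod q))).toAffine.negY x₀ y₀
      · rw [Affine.Point.add_self_of_Y_eq hy] at hPc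
        exact Affine.Point.some_ne_zero _ hPc
      · rw [Affine.Point.add_self_of_Y_ne hy, Affine.Point.some.injEq] at hPc
        obtain ⟨hx, -⟩ := hPc
        have hDval : y₀ - (V.map (Int.castRingHom (ZMod q))).toAffine.negY x₀ y₀ =
            2 * y₀ + (V.a₁ : ZMod q) * x₀ + (V.a₃ : ZMod q) := by
          simp only [Affine.negY, ha₁, ha₃]; ring
        have hD' : 2 * y₀ + (V.a₁ : ZMod q) * x₀ + (V.a₃ : ZMod q) ≠ 0 := by
          rw [← hDval]; exact sub_ne_zero.mpr hy
        have heq₀ : y₀ ^ 2 + (V.a₁ : ZMod q) * x₀ * y₀ + (V.a₃ : ZMod q) * y₀ =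
            x₀ ^ 3 + (V.a₂ : ZMod q) * x₀ ^ 2 + (V.a₄ : ZMod q) * x₀ + (V.a₆ : ZMod q) := by
          have := (Affine.equation_iff x₀ y₀).mp h₀.1
          simpa only [ha₁, ha₂, ha₃, ha₄, ha₆] using this
        have hL₀D : (V.map (Int.castRingHom (ZMod q))).toAffine.slope x₀ x₀ y₀ y₀ *
            (2 * y₀ + (V.a₁ : ZMod q) * x₀ + (V.a₃ : ZMod q)) =
            3 * x₀ ^ 2 + 2 * (V.a₂ : ZMod q) * x₀ + (V.a₄ : ZMod q) - (V.a₁ : ZMod q) * y₀ := by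
          rw [Affine.slope_of_Y_ne rfl hy, hDval, ha₁, ha₂, ha₄]; exact div_mul_cancel₀ _ hD'
        have hLd : (V.map (Int.castRingHom (ZMod q))).toAffine.slope α x₁ β y₁ * (α - x₁) =
            β - y₁ := by
          rw [Affine.slope_of_X_ne hne]; exact div_mul_cancel₀ _ (sub_ne_zero.mpr hne)
        have hx' := hx
        simp only [Affine.addX, ha₁, ha₂] at hx'
        apply hfree₂ x₀ y₀ heq₀ hD'
        rw [← hL₀D, ← hLd]
        linear_combination
          (-((2 * y₀ + (V.a₁ : ZMod q) * x₀ + (V.a₃ : ZMod q)) ^ 2 * (α - x₁) ^ 2)) * hx'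

end Coset

/-! ### The assembly for an annihilator `t ≡ 2 (mod 4)` -/

section Assembly

variable (V : WeierstrassCurve ℤ)

/-- **The kernel certificate gives `rank_ℤ E(ℚ) ≥ 2`, case `u = 1`.** As
`two_le_mordellWeilRank_of_kernelCert`, but the annihilator `t` read off the kernel point counts
satisfies `t % 4 = 2` (so `t = 2·m`, `m` odd — the case of a curve with a rational `2`-torsion point
and no rational `4`-torsion or full `2`-torsion), and the three witnesses are COSET TESTS
`xCosetFree V qᵢ x(Pᵢ) y(Pᵢ)`: `Pᵢ ∉ 2Ẽ(𝔽_{qᵢ}) + Ẽ(𝔽_{qᵢ})[2]`. Output `2 ≤ rank_ℤ E(ℚ)` by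
`two_le_mordellWeilRank_of_cosetWitness` with `u = 1`, `m = t / 2` and the reduction homomorphisms
`reduceMod V qᵢ`. [cite: SilvermanAEC2009, Prop. VII.3.1(b) and Thm. VIII.6.7]
[cite: CremonaAlgorithms1997, §3.5] -/
theorem two_le_mordellWeilRank_of_kernelCert₂ {X₁ Y₁ X₂ Y₂ X₃ Y₃ : ℤ}
    (h₁ : Y₁ ^ 2 + V.a₁ * X₁ * Y₁ + V.a₃ * Y₁ = X₁ ^ 3 + V.a₂ * X₁ ^ 2 + V.a₄ * X₁ + V.a₆)
    (h₂ : Y₂ ^ 2 + V.a₁ * X₂ * Y₂ + V.a₃ * Y₂ = X₂ ^ 3 + V.a₂ * X₂ ^ 2 + V.a₄ * X₂ + V.a₆)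
    (h₃ : Y₃ ^ 2 + V.a₁ * X₃ * Y₃ + V.a₃ * Y₃ = X₃ ^ 3 + V.a₂ * X₃ ^ 2 + V.a₄ * X₃ + V.a₆)
    (hc : intChord V X₁ Y₁ X₂ Y₂ X₃ Y₃ = true) {S : List (ℕ × ℕ)} {t : ℕ} (ht2 : t % 4 = 2)
    (hS : ∀ ℓN ∈ S, ℓN.1.Prime ∧
      ∀ (x : (V.map (Int.castRingHom ℚ)).toAffine.Point) (n : ℕ), ¬ ℓN.1 ∣ n → n • x = 0 →
        ℓN.2 • x = 0)
    (ht : annihilatorCheck S t = true) (q₁ q₂ q₃ : ℕ) [Fact q₁.Prime] [Fact q₂.Prime]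
    [Fact q₃.Prime] (hq₁ : ¬ (q₁ : ℤ) ∣ V.Δ) (hq₂ : ¬ (q₂ : ℤ) ∣ V.Δ) (hq₃ : ¬ (q₃ : ℤ) ∣ V.Δ)
    (hw₁ : xCosetFree V q₁ (X₁ : ZMod q₁) (Y₁ : ZMod q₁) = true)
    (hw₂ : xCosetFree V q₂ (X₂ : ZMod q₂) (Y₂ : ZMod q₂) = true)
    (hw₃ : xCosetFree V q₃ (X₃ : ZMod q₃) (Y₃ : ZMod q₃) = true) :
    2 ≤ (V.map (Int.castRingHom ℚ)).mordellWeilRank := by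
  classical
  have hΔ : V.Δ ≠ 0 := Δ_ne_zero_of_not_dvd V hq₁
  haveI := isElliptic_rat V hΔ
  have hm : Odd ((t / 2 : ℕ) : ℤ) := Int.odd_iff.mpr (by omega)
  have htm : (t : ℤ) = 2 ^ 1 * ((t / 2 : ℕ) : ℤ) := by rw [pow_one]; omega
  have htors : ∀ x : (V.map (Int.castRingHom ℚ)).toAffine.Point, IsOfFinAddOrder x →
      ((2 : ℤ) ^ 1 * ((t / 2 : ℕ) : ℤ)) • x = 0 :=
    fun x hx => zsmul_eq_zero_of_annihilatorCheck hS ht htm x hx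
  have e₁ : V.toAffine.Equation X₁ Y₁ := (Affine.equation_iff X₁ Y₁).mpr h₁
  have e₂ : V.toAffine.Equation X₂ Y₂ := (Affine.equation_iff X₂ Y₂).mpr h₂
  have e₃ : V.toAffine.Equation X₃ Y₃ := (Affine.equation_iff X₃ Y₃).mpr h₃
  refine two_le_mordellWeilRank_of_cosetWitness (V.map (Int.castRingHom ℚ)) hm htors
    (P₁ := .some _ _ (nonsingular_rat_of_eq V hΔ h₁))
    (P₂ := .some _ _ (nonsingular_rat_of_eq V hΔ h₂))
    (reduceMod V q₁ hq₁) (reduceMod V q₂ hq₂) (reduceMod V q₃ hq₃) ?_ ?_ ?_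
  · rw [reduceMod_some V q₁ hq₁ e₁]
    exact not_mem_twoCoset_one_of_xCosetFree V q₁ hw₁ _
  · rw [reduceMod_some V q₂ hq₂ e₂]
    exact not_mem_twoCoset_one_of_xCosetFree V q₂ hw₂ _
  · rw [some_add_some_of_intChord V hΔ h₁ h₂ h₃ hc, reduceMod_some V q₃ hq₃ e₃]
    exact not_mem_twoCoset_one_of_xCosetFree V q₃ hw₃ _

end Assembly

end Summit.BirchSwinnertonDyer.BirchSwinnertonDyer.Rank2Observatory
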